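import Literature.Analysis.Pluripotential.MongeAmpereComparison
import Literature.Analysis.Pluripotential.MongeAmpereStokes
import HarnessLib

/-!
# The Monge–Ampère mass defect caused by a logarithmic pole (smooth comparison principle)

Topic `Literature/Analysis/Pluripotential`. The quantitative core of the proof of the named fact
`GuedjZeriahi2007_lelongNumber_eq_zero_of_regularMass_eq` (`NonPluripolarMongeAmpereMass.lean`), in
the affine chart `ℂᴺ` and for SMOOTH data, assembling `MongeAmpereComparison.lean` (the comparison
function `b = compFun …`: a smoothed logarithmic pole of weight `t` glued into the floor
`(1+δ)c · fsPotential − K₀`), `MongeAmpereStokes.lean` (compactly supported perturbations do not change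
the total Monge–Ampère mass, `lintegral_heightDensity_add_eq`) and `MongeAmpereAffine.lean` (mass of
the bumps):

* `setLIntegral_add_setLIntegral_le_of_smoothMax` — **smooth comparison principle, mass form**: for
  `C³` functions `a, b, F` with `MA ≥ 0` (for `b`, `F`, `m₁(a,b)`), `m₁(a,b) − b` and `b − F` compactly
  supported, `∫_{S_a} MA(a) + ∫_{S_b} MA(b) ≤ ∫ MA(F)` whenever `MA(m₁(a,b)) = MA(a)` on `S_a`, `= MA(b)`
  on `S_b`, `S_a ∩ S_b = ∅` — because `∫ MA(m₁(a,b)) = ∫ MA(b) = ∫ MA(F)`. (This replaces GZ07's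
  comparison principle Thm. 1.5 / Prop. 1.6 in the smooth chart setting.)
* `setLIntegral_heightDensity_add_le_of_compFun` — the structural mass-defect inequality
  `∫_K MA(g) + tᴺ μ_FS(B(0,R)) ≤ c_Fᴺ` for a smooth `g` with Levi form `≥ 0`, given the order relations
  `g > b + 1` on `K`, `b > g + 1` on `B(w₀, Rη)`, `b ≥ g + 1` and `F ≥ P + 1` at infinity;
* the order relations from explicit bounds (`floorPart_add_one_le_polePart_of_shell`,
  `exists_forall_polePart_add_one_le_floorPart`, `exists_forall_add_one_le_compFun`,
  `compFun_add_one_lt_of_bounds`, `add_one_lt_compFun_of_pole`; elementary estimates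
  `sum_norm_sq_le`, `norm_sq_le_sum`, `fsPotential_le_of_norm_le`, `log_norm_le_fsPotential`,
  `polePart_le_of_norm_le`, `polePart_ge_of_le_dist`);
* `setLIntegral_heightDensity_add_le_of_logPole` — **the mass defect inequality with explicit
  constants**: `c > 0`, `0 < t ≤ c`, `δ > 0`, `g ∈ C³` with Levi `≥ 0` and `g ≤ c·fsPotential + M`,
  `K` bounded with `g ≥ m_K` on `K`, the pole bound `g ≤ γ log(Rη) + C_p` on `B(w₀, Rη)` and one
  explicit smallness condition on `η` give `∫_K MA(g) + tᴺ μ_FS(B(0,R)) ≤ ((1+δ)c)ᴺ`.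

Everything is PROVED; no definitions, no named facts.

## References

* [GuedjZeriahi2007] V. Guedj, A. Zeriahi, The weighted Monge–Ampère energy of quasiplurisubharmonic
  functions, J. Funct. Anal. 250 (2007): Thm. 1.5, Prop. 1.6, Cor. 1.8 and its proof (p. 451).
-/

noncomputable section

open scoped Topology ComplexOrder ENNReal
open MeasureTheory Filter Set Metric Complex
open Literature.AlgebraicGeometry.HodgeTheory.BiextensionHeight (leviMatrix heightDensity
  fsPotential)

namespace Literature.Analysis.Pluripotential

variable {N : ℕ}

/-! ### The abstract comparison inequality -/

/-- **Smooth comparison principle, mass form.** Let `a, b, F` be `C³` on `ℂᴺ` with non-negative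
Monge–Ampère densities `MA(b), MA(F), MA(m₁(a,b)) ≥ 0`, where `m₁` is the regularised maximum of
width `1`; assume `m₁(a,b) - b` and `b - F` have compact support. If `MA(m₁(a,b)) = MA(a)` on a
measurable set `S_a` and `= MA(b)` on a measurable set `S_b` disjoint from `S_a`, then
`∫_{S_a} MA(a) + ∫_{S_b} MA(b) ≤ ∫ MA(F)` (both sides in `[0, ∞]`): indeed
`∫ MA(m₁(a,b)) = ∫ MA(b) = ∫ MA(F)` by `lintegral_heightDensity_add_eq`. [folklore] -/
theorem setLIntegral_add_setLIntegral_le_of_smoothMax {a b F : (Fin N → ℂ) → ℝ}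
    (ha : ContDiff ℝ 3 a) (hb : ContDiff ℝ 3 b) (hF : ContDiff ℝ 3 F)
    (hMAb : ∀ w, 0 ≤ heightDensity N b w) (hMAF : ∀ w, 0 ≤ heightDensity N F w)
    (hMAw : ∀ w, 0 ≤ heightDensity N (fun w ↦ smoothMax 1 (a w) (b w)) w)
    (hwb : HasCompactSupport fun w ↦ smoothMax 1 (a w) (b w) - b w)
    (hbF : HasCompactSupport fun w ↦ b w - F w)
    {Sa Sb : Set (Fin N → ℂ)} (hSa : MeasurableSet Sa) (hSb : MeasurableSet Sb) (hdisj : Disjoint Sa Sb)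
    (hSa' : ∀ w ∈ Sa, heightDensity N (fun w ↦ smoothMax 1 (a w) (b w)) w = heightDensity N a w)
    (hSb' : ∀ w ∈ Sb, heightDensity N (fun w ↦ smoothMax 1 (a w) (b w)) w = heightDensity N b w) :
    (∫⁻ w in Sa, ENNReal.ofReal (heightDensity N a w))
      + ∫⁻ w in Sb, ENNReal.ofReal (heightDensity N b w)
      ≤ ∫⁻ w, ENNReal.ofReal (heightDensity N F w) := by
  set wfun : (Fin N → ℂ) → ℝ := fun w ↦ smoothMax 1 (a w) (b w) with hwfun
  have hwfun3 : ContDiff ℝ 3 wfun := (contDiff_smoothMax (η := 1)).comp (ha.prodMk hb)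
  -- `∫ MA(b) = ∫ MA(F)`
  have h1 : ∫⁻ w, ENNReal.ofReal (heightDensity N b w) = ∫⁻ w, ENNReal.ofReal (heightDensity N F w) := by
    have hfun : F + (fun w ↦ b w - F w) = b := by funext w; simp
    have key := lintegral_heightDensity_add_eq (N := N) hF (hb.sub hF) hbF hMAF
      (by rw [hfun]; exact hMAb)
    rw [hfun] at key
    exact key
  -- `∫ MA(wfun) = ∫ MA(b)`
  have h2 : ∫⁻ w, ENNReal.ofReal (heightDensity N wfun w) = ∫⁻ w, ENNReal.ofReal (heightDensity N b w) := by
    have hfun : b + (fun w ↦ wfun w - b w) = wfun := by funext w; simp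
    have key := lintegral_heightDensity_add_eq (N := N) hb (hwfun3.sub hb) hwb hMAb
      (by rw [hfun]; exact hMAw)
    rw [hfun] at key
    exact key
  -- restrict to `Sa ∪ Sb`
  have h3 : ∫⁻ w in Sa ∪ Sb, ENNReal.ofReal (heightDensity N wfun w)
      ≤ ∫⁻ w, ENNReal.ofReal (heightDensity N wfun w) := setLIntegral_le_lintegral _ _
  rw [lintegral_union hSb hdisj] at h3
  have h4 : ∫⁻ w in Sa, ENNReal.ofReal (heightDensity N wfun w)
      = ∫⁻ w in Sa, ENNReal.ofReal (heightDensity N a w) :=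
    setLIntegral_congr_fun hSa fun w hw ↦ by rw [hSa' w hw]
  have h5 : ∫⁻ w in Sb, ENNReal.ofReal (heightDensity N wfun w)
      = ∫⁻ w in Sb, ENNReal.ofReal (heightDensity N b w) :=
    setLIntegral_congr_fun hSb fun w hw ↦ by rw [hSb' w hw]
  rw [h4, h5, h2, h1] at h3
  exact h3

/-! ### The mass defect inequality for the glued comparison function -/

/-- **The comparison inequality for a smooth psh `g` against the glued comparison function `b`**
(structural form: the order relations between `g` and `b` on `K`, on the small ball and at infinity
are hypotheses): `∫_K MA(g) + tᴺ μ_FS(B(0, R)) ≤ c_Fᴺ`. [folklore] -/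
theorem setLIntegral_heightDensity_add_le_of_compFun {g : (Fin N → ℂ) → ℝ} (hg : ContDiff ℝ 3 g)
    (hLg : ∀ w v, 0 ≤ fderiv ℝ (fderiv ℝ g) w v v + fderiv ℝ (fderiv ℝ g) w (I • v) (I • v))
    {t C₃ η cF K₀ ρ₁ R R₁ R₂ : ℝ} {w₀ : Fin N → ℂ} (ht : 0 ≤ t) (hcF : 0 ≤ cF) (hρ₁ : 0 < ρ₁)
    (hη : 0 < η) (hRη : R * η ≤ ρ₁)
    (hshell : ∀ w, ρ₁ / 2 < dist w w₀ → dist w w₀ < ρ₁ → floorPart cF K₀ w + 1 ≤ polePart t C₃ η w₀ w)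
    (hfarF : ∀ w : Fin N → ℂ, R₁ ≤ ‖w‖ →
      ρ₁ ≤ dist w w₀ ∧ polePart t C₃ η w₀ w + 1 ≤ floorPart cF K₀ w)
    (hfarg : ∀ w : Fin N → ℂ, R₂ ≤ ‖w‖ → g w + 1 ≤ compFun t C₃ η w₀ cF K₀ ρ₁ w)
    {K : Set (Fin N → ℂ)} (hKm : MeasurableSet K)
    (hK : ∀ w ∈ K, compFun t C₃ η w₀ cF K₀ ρ₁ w + 1 < g w)
    (hball : ∀ w ∈ ball w₀ (R * η), g w + 1 < compFun t C₃ η w₀ cF K₀ ρ₁ w) :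
    (∫⁻ w in K, ENNReal.ofReal (heightDensity N g w))
      + ENNReal.ofReal (t ^ N) * ∫⁻ w in ball (0 : Fin N → ℂ) R,
          ENNReal.ofReal (heightDensity N fsPotential w)
      ≤ ENNReal.ofReal (cF ^ N) := by
  have hb3 : ContDiff ℝ 3 (compFun t C₃ η w₀ cF K₀ ρ₁) := contDiff_compFun hρ₁ hshell
  -- the ball term
  have hball_eq : ∫⁻ w in ball w₀ (R * η), ENNReal.ofReal (heightDensity N (compFun t C₃ η w₀ cF K₀ ρ₁) w)
      = ENNReal.ofReal (t ^ N) * ∫⁻ w in ball (0 : Fin N → ℂ) R,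
          ENNReal.ofReal (heightDensity N fsPotential w) := by
    have h1 : ∫⁻ w in ball w₀ (R * η), ENNReal.ofReal (heightDensity N (compFun t C₃ η w₀ cF K₀ ρ₁) w)
        = ∫⁻ w in ball w₀ (R * η), ENNReal.ofReal (heightDensity N (polePart t C₃ η w₀) w) :=
      setLIntegral_congr_fun measurableSet_ball fun w hw ↦ by
        rw [heightDensity_compFun_eq_polePart (lt_of_lt_of_le (mem_ball.1 hw) hRη)]
    rw [h1]
    exact setLIntegral_heightDensity_bump_ball ht _ hη w₀ R
  rw [← hball_eq, ← lintegral_heightDensity_floorPart (K₀ := K₀) hcF]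
  refine setLIntegral_add_setLIntegral_le_of_smoothMax hg hb3 contDiff_floorPart
    (heightDensity_compFun_nonneg ht hcF hρ₁ hshell) (heightDensity_floorPart_nonneg hcF)
    (heightDensity_smoothMax_compFun_nonneg (hg.of_le (by norm_num)) hLg ht hcF hρ₁ hshell)
    (hasCompactSupport_smoothMax_compFun_sub hfarg) (hasCompactSupport_compFun_sub_floorPart hfarF)
    hKm measurableSet_ball ?_ ?_ ?_
  · -- disjointness: `K ⊆ {g > b + 1}`, `ball ⊆ {b > g + 1}`
    refine Set.disjoint_left.2 fun w hwK hwB ↦ ?_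
    have h1 := hK w hwK
    have h2 := hball w hwB
    linarith
  · intro w hw
    exact heightDensity_smoothMax_compFun_eq_left hg.continuous hρ₁ hshell (hK w hw)
  · intro w hw
    exact heightDensity_smoothMax_compFun_eq_right hg.continuous hρ₁ hshell (hball w hw)

/-! ### Elementary bounds for the bookkeeping of constants -/

section Bounds

variable {t C₃ η cF K₀ : ℝ} {w₀ : Fin N → ℂ}

/-- `Σ_p |w_p|² ≤ N ‖w‖²` (sup norm). [folklore] -/
theorem sum_norm_sq_le (w : Fin N → ℂ) : ∑ p, ‖w p‖ ^ 2 ≤ N * ‖w‖ ^ 2 := by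
  have h := Finset.sum_le_card_nsmul Finset.univ (fun p ↦ ‖w p‖ ^ 2) (‖w‖ ^ 2)
    fun p _ ↦ by gcongr; exact norm_le_pi_norm w p
  simpa using h

/-- `‖w‖² ≤ Σ_p |w_p|²` (sup norm). [folklore] -/
theorem norm_sq_le_sum (w : Fin N → ℂ) : ‖w‖ ^ 2 ≤ ∑ p, ‖w p‖ ^ 2 := by
  rcases isEmpty_or_nonempty (Fin N) with hN | hN
  · simp [Subsingleton.elim w 0]
  · obtain ⟨k, hk⟩ := exists_norm_apply_eq_norm w
    rw [← hk]
    exact Finset.single_le_sum (fun p _ ↦ sq_nonneg ‖w p‖) (Finset.mem_univ k)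

/-- `fsPotential(w) ≤ ½ log(1 + N r²)` for `‖w‖ ≤ r`. [folklore] -/
theorem fsPotential_le_of_norm_le {w : Fin N → ℂ} {r : ℝ} (h : ‖w‖ ≤ r) :
    fsPotential w ≤ Real.log (1 + N * r ^ 2) / 2 := by
  unfold fsPotential
  have h1 : ∑ p, ‖w p‖ ^ 2 ≤ N * r ^ 2 :=
    (sum_norm_sq_le w).trans (by gcongr)
  have h0 : 0 < 1 + ∑ p, ‖w p‖ ^ 2 := one_add_sum_norm_sq_pos w
  gcongr

/-- `log ‖w‖ ≤ fsPotential(w)` for `w ≠ 0`. [folklore] -/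
theorem log_norm_le_fsPotential {w : Fin N → ℂ} (hw : 0 < ‖w‖) : Real.log ‖w‖ ≤ fsPotential w := by
  unfold fsPotential
  have h1 : ‖w‖ ^ 2 ≤ 1 + ∑ p, ‖w p‖ ^ 2 := by linarith [norm_sq_le_sum w]
  have h2 : Real.log (‖w‖ ^ 2) ≤ Real.log (1 + ∑ p, ‖w p‖ ^ 2) := Real.log_le_log (by positivity) h1
  rw [Real.log_pow] at h2
  push_cast at h2
  linarith

/-- **Upper bound on the pole part on a ball about the origin** (`t ≥ 0`, `0 < η ≤ 1`, `‖w‖ ≤ r`):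
`P(w) ≤ t/2 · log(1 + N (r + ‖w₀‖)²) + C₃`. [folklore] -/
theorem polePart_le_of_norm_le (ht : 0 ≤ t) (hη : 0 < η) (hη1 : η ≤ 1) {w : Fin N → ℂ} {r : ℝ}
    (h : ‖w‖ ≤ r) :
    polePart t C₃ η w₀ w ≤ t * (Real.log (1 + N * (r + ‖w₀‖) ^ 2) / 2) + C₃ := by
  refine (polePart_le ht hη hη1 w).trans ?_
  have h1 : ∑ p, ‖w p - w₀ p‖ ^ 2 ≤ N * (r + ‖w₀‖) ^ 2 := by
    have h2 : ∑ p, ‖w p - w₀ p‖ ^ 2 = ∑ p, ‖(w - w₀) p‖ ^ 2 := by simp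
    rw [h2]
    refine (sum_norm_sq_le (w - w₀)).trans ?_
    have h3 : ‖w - w₀‖ ≤ r + ‖w₀‖ := (norm_sub_le w w₀).trans (by linarith)
    gcongr
  have h0 : 0 < 1 + ∑ p, ‖w p - w₀ p‖ ^ 2 := by positivity
  gcongr

/-- **Lower bound on the pole part off a ball about `w₀`** (`t ≥ 0`, `η > 0`, `0 < d ≤ dist(w, w₀)`):
`t log d + C₃ ≤ P(w)`. [folklore] -/
theorem polePart_ge_of_le_dist (ht : 0 ≤ t) (hη : 0 < η) {w : Fin N → ℂ} {d : ℝ} (hd : 0 < d)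
    (h : d ≤ dist w w₀) : t * Real.log d + C₃ ≤ polePart t C₃ η w₀ w := by
  rw [polePart_eq_log hη]
  have h1 : d ^ 2 ≤ η ^ 2 + ∑ p, ‖w p - w₀ p‖ ^ 2 := by
    have h2 : ∑ p, ‖w p - w₀ p‖ ^ 2 = ∑ p, ‖(w - w₀) p‖ ^ 2 := by simp
    rw [h2]
    have h3 : ‖w - w₀‖ ^ 2 ≤ ∑ p, ‖(w - w₀) p‖ ^ 2 := norm_sq_le_sum (w - w₀)
    rw [← dist_eq_norm] at h3
    nlinarith [sq_nonneg η, dist_nonneg (x := w) (y := w₀)]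
  have h4 : Real.log (d ^ 2) ≤ Real.log (η ^ 2 + ∑ p, ‖w p - w₀ p‖ ^ 2) :=
    Real.log_le_log (by positivity) h1
  rw [Real.log_pow] at h4
  push_cast at h4
  nlinarith

end Bounds

/-! ### The order relations required by the comparison, from explicit bounds -/

section Relations

variable {t C₃ η cF K₀ : ℝ} {w₀ : Fin N → ℂ}

/-- **Shell relation**: with `C₃ ≥ c_F · ½log(1 + N(‖w₀‖+1)²) - K₀ + 1 + t log 2` the floor plus the
gluing width stays below the pole part on the shell `½ < dist(·, w₀) < 1`. [folklore] -/
theorem floorPart_add_one_le_polePart_of_shell (ht : 0 ≤ t) (hcF : 0 ≤ cF) (hη : 0 < η)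
    (hC₃ : cF * (Real.log (1 + N * (‖w₀‖ + 1) ^ 2) / 2) - K₀ + 1 + t * Real.log 2 ≤ C₃)
    (w : Fin N → ℂ) (h1 : 1 / 2 < dist w w₀) (h2 : dist w w₀ < 1) :
    floorPart cF K₀ w + 1 ≤ polePart t C₃ η w₀ w := by
  have hw : ‖w‖ ≤ ‖w₀‖ + 1 := by
    have := norm_le_norm_add_norm_sub' w w₀
    rw [← dist_eq_norm] at this
    linarith
  have hF : floorPart cF K₀ w ≤ cF * (Real.log (1 + N * (‖w₀‖ + 1) ^ 2) / 2) + (-K₀) := by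
    unfold floorPart
    have := mul_le_mul_of_nonneg_left (fsPotential_le_of_norm_le hw) hcF
    linarith
  have hP : t * Real.log (1 / 2) + C₃ ≤ polePart t C₃ η w₀ w :=
    polePart_ge_of_le_dist ht hη (by norm_num) h1.le
  have hl : Real.log (1 / 2) = -Real.log 2 := by rw [one_div, Real.log_inv]
  rw [hl] at hP
  linarith

/-- **Far relation for the floor**: if `t < c_F` then, outside a large ball, we are off `B(w₀, 1)` and
the floor exceeds the pole part by the gluing width (`0 < η ≤ 1`). [folklore] -/
theorem exists_forall_polePart_add_one_le_floorPart (ht : 0 ≤ t) (hcFt : t < cF) (hη : 0 < η)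
    (hη1 : η ≤ 1) :
    ∃ R₁ : ℝ, ∀ w : Fin N → ℂ, R₁ ≤ ‖w‖ →
      1 ≤ dist w w₀ ∧ polePart t C₃ η w₀ w + 1 ≤ floorPart cF K₀ w := by
  set B₁ := K₀ + C₃ + 1 + t * (Real.log (1 + 4 * N) / 2) with hB₁
  refine ⟨max (‖w₀‖ + 1) (Real.exp (B₁ / (cF - t))), fun w hw ↦ ?_⟩
  have hw1 : ‖w₀‖ + 1 ≤ ‖w‖ := (le_max_left _ _).trans hw
  have hwexp : Real.exp (B₁ / (cF - t)) ≤ ‖w‖ := (le_max_right _ _).trans hw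
  have hwpos : 0 < ‖w‖ := by linarith [norm_nonneg w₀]
  have hdist : 1 ≤ dist w w₀ := by
    rw [dist_eq_norm]
    linarith [abs_le.1 (abs_norm_sub_norm_le w w₀)]
  refine ⟨hdist, ?_⟩
  set L := Real.log ‖w‖ with hL
  have hct : 0 < cF - t := by linarith
  have hlogw : B₁ ≤ (cF - t) * L := by
    have : B₁ / (cF - t) ≤ L := by
      rw [hL, Real.le_log_iff_exp_le hwpos]
      exact hwexp
    rwa [div_le_iff₀ hct, mul_comm] at this
  -- the pole part
  have hP : polePart t C₃ η w₀ w ≤ t * L + t * (Real.log (1 + 4 * N) / 2) + C₃ := by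
    refine (polePart_le_of_norm_le ht hη hη1 le_rfl).trans ?_
    have hy : ‖w₀‖ ≤ ‖w‖ := by linarith
    have h4 : (‖w‖ + ‖w₀‖) ^ 2 ≤ 4 * ‖w‖ ^ 2 := by
      nlinarith only [hy, norm_nonneg w₀, norm_nonneg w]
    have hN : (0 : ℝ) ≤ N := Nat.cast_nonneg N
    have h5 : (N : ℝ) * (‖w‖ + ‖w₀‖) ^ 2 ≤ N * (4 * ‖w‖ ^ 2) := mul_le_mul_of_nonneg_left h4 hN
    have h6 : (1 : ℝ) ≤ ‖w‖ ^ 2 := by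
      have h1' : 1 ≤ ‖w‖ := by linarith [norm_nonneg w₀]
      nlinarith only [h1']
    have hq : 1 + (N : ℝ) * (‖w‖ + ‖w₀‖) ^ 2 ≤ (1 + 4 * N) * ‖w‖ ^ 2 := by
      linarith only [h5, h6, hN]
    have hpos1 : 0 < 1 + (N : ℝ) * (‖w‖ + ‖w₀‖) ^ 2 := by positivity
    have hlog : Real.log (1 + N * (‖w‖ + ‖w₀‖) ^ 2) ≤ Real.log ((1 + 4 * N) * ‖w‖ ^ 2) :=
      Real.log_le_log hpos1 hq
    have hmul : Real.log ((1 + 4 * (N : ℝ)) * ‖w‖ ^ 2) = Real.log (1 + 4 * N) + 2 * L := by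
      rw [Real.log_mul (by positivity) (by positivity), Real.log_pow]
      push_cast
      ring
    rw [hmul] at hlog
    have h7 := mul_le_mul_of_nonneg_left hlog (by positivity : (0 : ℝ) ≤ t / 2)
    have h8 : t * (Real.log (1 + N * (‖w‖ + ‖w₀‖) ^ 2) / 2)
        = t / 2 * Real.log (1 + N * (‖w‖ + ‖w₀‖) ^ 2) := by ring
    have h9 : t / 2 * (Real.log (1 + 4 * N) + 2 * L) = t * L + t * (Real.log (1 + 4 * N) / 2) := by
      ring
    linarith only [h7, h8, h9]
  -- the floor
  have hF : cF * L + (-K₀) ≤ floorPart cF K₀ w := by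
    unfold floorPart
    have := mul_le_mul_of_nonneg_left (log_norm_le_fsPotential hwpos) (by linarith : (0 : ℝ) ≤ cF)
    linarith only [this]
  have h10 : (cF - t) * L = cF * L - t * L := by ring
  rw [h10, hB₁] at hlogw
  linarith only [hP, hF, hlogw]

/-- **Far relation for `g`**: if `g ≤ c · fsPotential + M` and `c_F = (1 + δ)c` with `δ, c > 0`, then
`g + 1 ≤ b` outside a large ball (since `b ≥ floorPart` off `B(w₀, 1)`). [folklore] -/
theorem exists_forall_add_one_le_compFun {c δ M : ℝ} {g : (Fin N → ℂ) → ℝ} (hc : 0 < c) (hδ : 0 < δ)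
    (hgq : ∀ w, g w ≤ c * fsPotential w + M) :
    ∃ R₂ : ℝ, ∀ w : Fin N → ℂ, R₂ ≤ ‖w‖ → g w + 1 ≤ compFun t C₃ η w₀ ((1 + δ) * c) K₀ 1 w := by
  refine ⟨max (‖w₀‖ + 1) (Real.exp ((M + K₀ + 1) / (δ * c))), fun w hw ↦ ?_⟩
  have hw1 : ‖w₀‖ + 1 ≤ ‖w‖ := (le_max_left _ _).trans hw
  have hwexp : Real.exp ((M + K₀ + 1) / (δ * c)) ≤ ‖w‖ := (le_max_right _ _).trans hw
  have hwpos : 0 < ‖w‖ := by linarith [norm_nonneg w₀]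
  have hdist : 1 ≤ dist w w₀ := by
    rw [dist_eq_norm]
    linarith [abs_le.1 (abs_norm_sub_norm_le w w₀)]
  have hδc : 0 < δ * c := by positivity
  have hlogw : M + K₀ + 1 ≤ δ * c * Real.log ‖w‖ := by
    have : (M + K₀ + 1) / (δ * c) ≤ Real.log ‖w‖ := by
      rw [Real.le_log_iff_exp_le hwpos]
      exact hwexp
    rwa [div_le_iff₀ hδc, mul_comm] at this
  have hfs := log_norm_le_fsPotential hwpos
  have hb : floorPart ((1 + δ) * c) K₀ w ≤ compFun t C₃ η w₀ ((1 + δ) * c) K₀ 1 w :=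
    (le_max_right _ _).trans (max_le_compFun hdist)
  unfold floorPart at hb
  have h5 : δ * c * Real.log ‖w‖ ≤ δ * c * fsPotential w := mul_le_mul_of_nonneg_left hfs hδc.le
  have h6 : (1 + δ) * c * fsPotential w = c * fsPotential w + δ * c * fsPotential w := by ring
  linarith only [hgq w, hb, h5, h6, hlogw]

/-- **Relation on `K`**: if `‖w‖ ≤ R_K`, `g w ≥ m_K` on `K` and both `tΛ'_K + C₃` and
`c_FΛ_K - K₀` are `≤ m_K - 3`, then `b + 1 < g` on `K` (`t ≥ 0`, `0 < η ≤ 1`). [folklore] -/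
theorem compFun_add_one_lt_of_bounds {RK mK : ℝ} {g : (Fin N → ℂ) → ℝ} {K : Set (Fin N → ℂ)}
    (ht : 0 ≤ t) (hcF : 0 ≤ cF) (hη : 0 < η) (hη1 : η ≤ 1)
    (hKbdd : ∀ w ∈ K, ‖w‖ ≤ RK) (hKg : ∀ w ∈ K, mK ≤ g w)
    (h₁ : t * (Real.log (1 + N * (RK + ‖w₀‖) ^ 2) / 2) + C₃ ≤ mK - 3)
    (h₂ : cF * (Real.log (1 + N * RK ^ 2) / 2) - K₀ ≤ mK - 3) {ρ₁ : ℝ}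
    (w : Fin N → ℂ) (hw : w ∈ K) : compFun t C₃ η w₀ cF K₀ ρ₁ w + 1 < g w := by
  have hb := compFun_le_max_add_one (t := t) (C₃ := C₃) (η := η) (w₀ := w₀) (cF := cF) (K₀ := K₀)
    (ρ₁ := ρ₁) w
  have hP : polePart t C₃ η w₀ w ≤ t * (Real.log (1 + N * (RK + ‖w₀‖) ^ 2) / 2) + C₃ :=
    polePart_le_of_norm_le ht hη hη1 (hKbdd w hw)
  have hF : floorPart cF K₀ w ≤ cF * (Real.log (1 + N * RK ^ 2) / 2) + (-K₀) := by
    unfold floorPart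
    have := mul_le_mul_of_nonneg_left (fsPotential_le_of_norm_le (hKbdd w hw)) hcF
    linarith only [this]
  have hmax : max (polePart t C₃ η w₀ w) (floorPart cF K₀ w) ≤ mK - 3 :=
    max_le (by linarith only [hP, h₁]) (by linarith only [hF, h₂])
  linarith only [hb, hmax, hKg w hw]

/-- **Relation on the small ball**: the pole bound `g ≤ γ log(Rη) + C_p` on `B(w₀, Rη)` (`Rη ≤ ρ₁`)
and the smallness condition `γ log(Rη) + C_p + 1 < t log η + C₃` give `g + 1 < b` there (`t ≥ 0`).
[folklore] -/
theorem add_one_lt_compFun_of_pole {γ Cp R ρ₁ : ℝ} {g : (Fin N → ℂ) → ℝ} (ht : 0 ≤ t)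
    (hRη : R * η ≤ ρ₁) (hpole : ∀ w ∈ ball w₀ (R * η), g w ≤ γ * Real.log (R * η) + Cp)
    (hsmall : γ * Real.log (R * η) + Cp + 1 < t * Real.log η + C₃)
    (w : Fin N → ℂ) (hw : w ∈ ball w₀ (R * η)) : g w + 1 < compFun t C₃ η w₀ cF K₀ ρ₁ w := by
  have hwd : dist w w₀ < ρ₁ := lt_of_lt_of_le (mem_ball.1 hw) hRη
  rw [compFun_eq_polePart hwd]
  have hP := polePart_ge (C₃ := C₃) (η := η) (w₀ := w₀) ht w
  linarith only [hP, hpole w hw, hsmall]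

end Relations

/-! ### The mass defect inequality with explicit constants -/

/-- **Mass defect from a logarithmic pole, smooth case.** Let `c > 0`, `0 < t ≤ c`, `δ > 0`,
`q = c · fsPotential`, and let `g : ℂᴺ → ℝ` be `C³` with non-negative Levi form and `g ≤ q + M`. Let
`K` be a measurable set with `‖w‖ ≤ R_K` and `g ≥ m_K` on `K`. Fix `w₀`, `0 < η ≤ 1`, `R` with
`Rη ≤ 1`, the POLE BOUND `g ≤ γ log(Rη) + C_p` on `B(w₀, Rη)`, a constant `K₀` with
`tΛ'_K + c_FΛ₁ + 1 + t log 2 ≤ K₀ + m_K - 3` and `c_FΛ_K ≤ K₀ + m_K - 3`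
(`c_F = (1+δ)c`, `Λ₁ = ½log(1 + N(‖w₀‖+1)²)`, `Λ_K = ½log(1 + N R_K²)`, `Λ'_K = ½log(1 + N(R_K + ‖w₀‖)²)`),
`C₃ := c_FΛ₁ - K₀ + 1 + t log 2`, and assume the smallness condition
`γ log(Rη) + C_p + 1 < t log η + C₃`. Then `∫_K MA(g) + tᴺ μ_FS(B(0,R)) ≤ ((1+δ)c)ᴺ`.
(Comparison function `compFun t C₃ η w₀ c_F K₀ 1`; this is the smooth chart-level form of the
argument of Guedj–Zeriahi, Cor. 1.8.) [cite: GuedjZeriahi2007, Cor. 1.8 (proof)] -/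
theorem setLIntegral_heightDensity_add_le_of_logPole {c t δ M RK mK γ Cp R η K₀ : ℝ}
    {g : (Fin N → ℂ) → ℝ} {w₀ : Fin N → ℂ} (hc : 0 < c) (ht : 0 < t) (htc : t ≤ c) (hδ : 0 < δ)
    (hg : ContDiff ℝ 3 g)
    (hLg : ∀ w v, 0 ≤ fderiv ℝ (fderiv ℝ g) w v v + fderiv ℝ (fderiv ℝ g) w (I • v) (I • v))
    (hgq : ∀ w, g w ≤ c * fsPotential w + M)
    {K : Set (Fin N → ℂ)} (hKm : MeasurableSet K) (hKbdd : ∀ w ∈ K, ‖w‖ ≤ RK)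
    (hKg : ∀ w ∈ K, mK ≤ g w)
    (hη : 0 < η) (hη1 : η ≤ 1) (hRη : R * η ≤ 1)
    (hpole : ∀ w ∈ ball w₀ (R * η), g w ≤ γ * Real.log (R * η) + Cp)
    (hK₀₁ : t * (Real.log (1 + N * (RK + ‖w₀‖) ^ 2) / 2)
      + (1 + δ) * c * (Real.log (1 + N * (‖w₀‖ + 1) ^ 2) / 2) + 1 + t * Real.log 2 ≤ K₀ + mK - 3)
    (hK₀₂ : (1 + δ) * c * (Real.log (1 + N * RK ^ 2) / 2) ≤ K₀ + mK - 3)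
    (hsmall : γ * Real.log (R * η) + Cp + 1 < t * Real.log η
      + ((1 + δ) * c * (Real.log (1 + N * (‖w₀‖ + 1) ^ 2) / 2) - K₀ + 1 + t * Real.log 2)) :
    (∫⁻ w in K, ENNReal.ofReal (heightDensity N g w))
      + ENNReal.ofReal (t ^ N) * ∫⁻ w in ball (0 : Fin N → ℂ) R,
          ENNReal.ofReal (heightDensity N fsPotential w)
      ≤ ENNReal.ofReal (((1 + δ) * c) ^ N) := by
  have hcFpos : 0 < (1 + δ) * c := by positivity
  have hcFt : t < (1 + δ) * c := by nlinarith
  obtain ⟨R₁, hR₁⟩ := exists_forall_polePart_add_one_le_floorPart (N := N)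
    (C₃ := (1 + δ) * c * (Real.log (1 + N * (‖w₀‖ + 1) ^ 2) / 2) - K₀ + 1 + t * Real.log 2)
    (K₀ := K₀) (w₀ := w₀) ht.le hcFt hη hη1
  obtain ⟨R₂, hR₂⟩ := exists_forall_add_one_le_compFun (N := N) (t := t)
    (C₃ := (1 + δ) * c * (Real.log (1 + N * (‖w₀‖ + 1) ^ 2) / 2) - K₀ + 1 + t * Real.log 2)
    (η := η) (w₀ := w₀) (K₀ := K₀) hc hδ hgq
  exact setLIntegral_heightDensity_add_le_of_compFun hg hLg ht.le hcFpos.le one_pos hη hRη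
    (floorPart_add_one_le_polePart_of_shell ht.le hcFpos.le hη le_rfl) hR₁ hR₂ hKm
    (compFun_add_one_lt_of_bounds ht.le hcFpos.le hη hη1 hKbdd hKg (by linarith) (by linarith))
    (add_one_lt_compFun_of_pole ht.le hRη hpole hsmall)

end Literature.Analysis.Pluripotential

end
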